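import Summits.QuantumFields.YangMills.Theorems.ParabolicTrajectoryLatticeGapOnTrajectoryStubTiltChessboardStepAux
import Summits.QuantumFields.YangMills.Theorems.ParabolicTrajectoryLatticeGapOnTrajectoryStubOddRPCrossTilt
import Literature.MathematicalPhysics.QuantumFieldTheory.ConstructiveQFTWave0Proofs
import HarnessLib

/-!
# Crux `NonSimplyConnectedLatticeGap` (stmt-QuantumFields-16405), line `Sketch`:
# stub (SCHWARZ-SPATIAL) `stub_tiltSchwarz_spatial` — the reflection Schwarz inequality for the
# tilt functionals of a spatial orientation class on the odd four-torus

For the tilt functionals `Ψ(c) := E_β exp(-∑ₓ c(x) Re tr ρ(U_{(x,o)}))` of a fixed SPATIAL plane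
`o` (`o.1.1 ≠ 0`) on the odd torus `(ℤ/(2S+1))⁴`, `S ≥ 1`, and every profile `e` we prove
`Ψ(e)² ≤ Ψ(e⁺) Ψ(e⁻)`, where, for the reflection `r x = x[0 := 1 - x₀]` of base sites (the site
part of `WilsonRP.plaqReflect (x, o)` for a spatial plane; `1 = 2 (S + 1)` in `ℤ/(2S+1)`, fixed
layer `x₀ = S + 1`), `e⁺` keeps the layers `1 ≤ x₀ ≤ S + 1` (`((S + 1) - x₀).val ≤ S`) and is
`e ∘ r` elsewhere, and `e⁻` keeps the layers `x₀ ∈ {0} ∪ [S + 1, 2S]` (`(x₀ - (S + 1)).val ≤ S`).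

Route: the landed reflection Schwarz inequality `schwarz_profiles` of crux `LatticeGapOnTrajectory`
(odd-torus Osterwalder–Seiler positivity with a crossing tilt, its hypothesis (A) being the landed
`stub_oddRPCrossTilt`), `Ψ(eQ ∘ r + eP + w)² ≤ Ψ(eP ∘ r + eP + w) Ψ(eQ ∘ r + eQ + w)`, applied with
the crossing profile `w = 0` and the half profiles
`eP = e` on the layers `[1, S]`, `e / 2` on the fixed layer `S + 1`, `0` elsewhere,
`eQ = e ∘ r` on the layers `[1, S]`, `e / 2` on the fixed layer `S + 1`, `0` elsewhere;
the three combined profiles are pointwise `e`, `e⁺`, `e⁻` (layer bookkeeping on the odd cycle).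
-/

set_option autoImplicit false

namespace Summit.QuantumFields.YangMills.Theorems.NonSimplyConnectedLatticeGap

open scoped BigOperators
open MeasureTheory Literature.MathematicalPhysics.QuantumFieldTheory
open Summit.QuantumFields.QCD.Cruxes.WindowExtinction.ChessboardColdCells
open Summit.QuantumFields.YangMills.Cruxes.LatticeGapOnTrajectory.SparseDefectOrbitWindow

/-! ## Layer bookkeeping on the odd cycle `ℤ/(2S+1)` -/

/-- `2 (S + 1) = 1` in `ℤ/(2S+1)`. -/
theorem tiltSchwarzSpatial_two_mul_mid (S : ℕ) : 2 * ((S : ZMod (2 * S + 1)) + 1) = 1 := by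
  have h : 2 * ((S : ZMod (2 * S + 1)) + 1) = ((2 * S + 1 : ℕ) : ZMod (2 * S + 1)) + 1 := by
    push_cast; ring
  rw [h, ZMod.natCast_self, zero_add]

/-- With `m = S + 1 ∈ ℤ/(2S+1)`, `S ≥ 1`: `(m - t).val ≤ S` iff `1 ≤ t ≤ S + 1`. -/
theorem tiltSchwarzSpatial_val_mid_sub_le_iff {S : ℕ} (hS : 1 ≤ S) (t : ZMod (2 * S + 1)) :
    (((S : ZMod (2 * S + 1)) + 1) - t).val ≤ S ↔ 1 ≤ t.val ∧ t.val ≤ S + 1 := by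
  have ht := ZMod.val_lt t
  have h : ((S : ZMod (2 * S + 1)) + 1) - t =
      ((S + 1 : ℕ) : ZMod (2 * S + 1)) - (t.val : ZMod (2 * S + 1)) := by
    rw [ZMod.natCast_zmod_val, Nat.cast_succ]
  rw [h, OddCycle.val_natCast_sub_natCast (show S + 1 < 2 * S + 1 by omega) ht]
  split_ifs <;> omega

/-- With `m = S + 1 ∈ ℤ/(2S+1)`, `S ≥ 1`: `(t - m).val ≤ S` iff `t = 0` or `S + 1 ≤ t`. -/
theorem tiltSchwarzSpatial_val_sub_mid_le_iff {S : ℕ} (hS : 1 ≤ S) (t : ZMod (2 * S + 1)) :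
    (t - ((S : ZMod (2 * S + 1)) + 1)).val ≤ S ↔ t.val = 0 ∨ S + 1 ≤ t.val := by
  have ht := ZMod.val_lt t
  rw [show ((S : ZMod (2 * S + 1)) + 1) = ((S + 1 : ℕ) : ZMod (2 * S + 1)) by rw [Nat.cast_succ],
    OddCycle.val_sub_natCast (show S + 1 < 2 * S + 1 by omega)]
  split_ifs <;> omega

/-! ## The site reflection of a spatial class -/

/-- For a spatial plane the site part of the plaquette reflection is the time reflection
`x ↦ x[0 := 1 - x₀]`. -/
theorem tiltSchwarzSpatial_plaqReflect_fst {S : ℕ} (o : {q : Fin 4 × Fin 4 // q.1 < q.2})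
    (ho : o.1.1 ≠ 0) (x : Site 4 (2 * S + 1)) :
    (WilsonRP.plaqReflect (x, o)).1 = x.timeReflect := by
  simp [WilsonRP.plaqReflect, ho]

/-- The reflection written about the fixed layer `S + 1`:
`x[0 := 2 (S + 1) - x₀] = x[0 := 1 - x₀]`. -/
theorem tiltSchwarzSpatial_update_eq_timeReflect {S : ℕ} (x : Site 4 (2 * S + 1)) :
    Function.update x 0 (2 * ((S : ZMod (2 * S + 1)) + 1) - x 0) = x.timeReflect := by
  rw [tiltSchwarzSpatial_two_mul_mid]
  rfl

/-- The reflection fixes the sites of the layer `S + 1`. -/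
theorem tiltSchwarzSpatial_timeReflect_of_val_eq {S : ℕ} (hS : 1 ≤ S) (x : Site 4 (2 * S + 1))
    (hx : (x 0).val = S + 1) : x.timeReflect = x := by
  have h1 : (1 : ZMod (2 * S + 1)) - x 0 = x 0 := by
    apply ZMod.val_injective
    rw [OddCycle.val_one_sub hS, hx, if_neg (by omega)]
    omega
  show Function.update x 0 (1 - x 0) = x
  rw [h1, Function.update_eq_self]

/-- **Layer trichotomy.** A site lies in the open kept half `1 ≤ x₀ ≤ S` (and then its reflection
lies in neither kept part), or on the fixed layer `S + 1`, or in the complement (and then its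
reflection lies in the open kept half). -/
theorem tiltSchwarzSpatial_layers {S : ℕ} (hS : 1 ≤ S) (x : Site 4 (2 * S + 1)) :
    (1 ≤ (x 0).val ∧ (x 0).val ≤ S ∧
        ¬(1 ≤ (x.timeReflect 0).val ∧ (x.timeReflect 0).val ≤ S) ∧
        (x.timeReflect 0).val ≠ S + 1) ∨
      ((x 0).val = S + 1 ∧ x.timeReflect = x) ∨
      (¬(1 ≤ (x 0).val ∧ (x 0).val ≤ S) ∧ (x 0).val ≠ S + 1 ∧
        1 ≤ (x.timeReflect 0).val ∧ (x.timeReflect 0).val ≤ S) := by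
  have hv := ZMod.val_lt (x 0)
  have hy : (x.timeReflect 0).val =
      if (x 0).val ≤ 1 then 1 - (x 0).val else 1 + (2 * S + 1) - (x 0).val := by
    rw [WilsonRP.timeReflect_apply_zero, OddCycle.val_one_sub hS]
  by_cases ha : 1 ≤ (x 0).val ∧ (x 0).val ≤ S
  · refine Or.inl ⟨ha.1, ha.2, ?_, ?_⟩ <;> rw [hy] <;> split_ifs <;> omega
  · by_cases hb : (x 0).val = S + 1
    · exact Or.inr (Or.inl ⟨hb, tiltSchwarzSpatial_timeReflect_of_val_eq hS x hb⟩)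
    · refine Or.inr (Or.inr ⟨ha, hb, ?_, ?_⟩) <;> rw [hy] <;> split_ifs <;> omega

/-! ## The half profiles and the three combined profiles -/

section Profiles

variable {S : ℕ} (hS : 1 ≤ S) (o : {q : Fin 4 × Fin 4 // q.1 < q.2}) (ho : o.1.1 ≠ 0)
  (e eP eQ w : Site 4 (2 * S + 1) → ℝ)
  (hP : ∀ x, eP x =
    if 1 ≤ (x 0).val ∧ (x 0).val ≤ S then e x else if (x 0).val = S + 1 then e x / 2 else 0)
  (hQ : ∀ x, eQ x =
    if 1 ≤ (x 0).val ∧ (x 0).val ≤ S then e x.timeReflect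
    else if (x 0).val = S + 1 then e x / 2 else 0)
  (hw : ∀ x, w x = 0)

include hS ho hP hQ hw

omit hS hP hQ hw in
/-- The half profiles live on the kept layers `1 ≤ x₀ ≤ S` and `x₀ = S + 1` (spatial plane). -/
theorem tiltSchwarzSpatial_support (f g : Site 4 (2 * S + 1) → ℝ)
    (hf : ∀ x, f x =
      if 1 ≤ (x 0).val ∧ (x 0).val ≤ S then g x else if (x 0).val = S + 1 then e x / 2 else 0)
    (x : Site 4 (2 * S + 1)) (hx : f x ≠ 0) :
    (1 ≤ (x 0).val ∧ (x 0).val ≤ S) ∨ (o.1.1 ≠ 0 ∧ (x 0).val = S + 1) := by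
  rw [hf] at hx
  by_cases ha : 1 ≤ (x 0).val ∧ (x 0).val ≤ S
  · exact Or.inl ha
  · rw [if_neg ha] at hx
    by_cases hb : (x 0).val = S + 1
    · exact Or.inr ⟨ho, hb⟩
    · exact absurd (if_neg hb) hx

/-- The mixed profile `eQ ∘ r + eP + w` is `e`. -/
theorem tiltSchwarzSpatial_profile_mixed (x : Site 4 (2 * S + 1)) :
    eQ (WilsonRP.plaqReflect (x, o)).1 + eP x + w x = e x := by
  rw [tiltSchwarzSpatial_plaqReflect_fst o ho, hw, add_zero]
  rcases tiltSchwarzSpatial_layers hS x with ⟨ha1, ha2, hy1, hy2⟩ | ⟨hb, hfix⟩ | ⟨ha, hb, hy1, hy2⟩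
  · rw [hQ x.timeReflect, if_neg hy1, if_neg hy2, hP x, if_pos ⟨ha1, ha2⟩, zero_add]
  · have ha : ¬(1 ≤ (x 0).val ∧ (x 0).val ≤ S) := by omega
    rw [hfix, hQ x, if_neg ha, if_pos hb, hP x, if_neg ha, if_pos hb]
    ring
  · rw [hP x, if_neg ha, if_neg hb, add_zero, hQ x.timeReflect, if_pos ⟨hy1, hy2⟩,
      WilsonRP.timeReflect_timeReflect]

omit hQ in
/-- The profile `eP ∘ r + eP + w` is `e⁺` (keep the layers `1 ≤ x₀ ≤ S + 1`, reflect elsewhere). -/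
theorem tiltSchwarzSpatial_profile_plus (x : Site 4 (2 * S + 1)) :
    eP (WilsonRP.plaqReflect (x, o)).1 + eP x + w x =
      if (((S : ZMod (2 * S + 1)) + 1) - x 0).val ≤ S then e x
      else e (Function.update x 0 (2 * ((S : ZMod (2 * S + 1)) + 1) - x 0)) := by
  rw [tiltSchwarzSpatial_plaqReflect_fst o ho, hw, add_zero,
    tiltSchwarzSpatial_update_eq_timeReflect]
  have hv := ZMod.val_lt (x 0)
  have hc := tiltSchwarzSpatial_val_mid_sub_le_iff hS (x 0)
  rcases tiltSchwarzSpatial_layers hS x with ⟨ha1, ha2, hy1, hy2⟩ | ⟨hb, hfix⟩ | ⟨ha, hb, hy1, hy2⟩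
  · rw [if_pos (hc.2 ⟨ha1, by omega⟩), hP x.timeReflect, if_neg hy1, if_neg hy2, hP x,
      if_pos ⟨ha1, ha2⟩, zero_add]
  · have ha : ¬(1 ≤ (x 0).val ∧ (x 0).val ≤ S) := by omega
    rw [if_pos (hc.2 ⟨by omega, by omega⟩), hfix, hP x, if_neg ha, if_pos hb]
    ring
  · have hc' : ¬((((S : ZMod (2 * S + 1)) + 1) - x 0).val ≤ S) := by
      rw [hc]; omega
    rw [if_neg hc', hP x, if_neg ha, if_neg hb, add_zero, hP x.timeReflect, if_pos ⟨hy1, hy2⟩]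

omit hP in
/-- The profile `eQ ∘ r + eQ + w` is `e⁻` (keep the layers `x₀ ∈ {0} ∪ [S + 1, 2S]`, reflect
elsewhere). -/
theorem tiltSchwarzSpatial_profile_minus (x : Site 4 (2 * S + 1)) :
    eQ (WilsonRP.plaqReflect (x, o)).1 + eQ x + w x =
      if (x 0 - ((S : ZMod (2 * S + 1)) + 1)).val ≤ S then e x
      else e (Function.update x 0 (2 * ((S : ZMod (2 * S + 1)) + 1) - x 0)) := by
  rw [tiltSchwarzSpatial_plaqReflect_fst o ho, hw, add_zero,
    tiltSchwarzSpatial_update_eq_timeReflect]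
  have hv := ZMod.val_lt (x 0)
  have hc := tiltSchwarzSpatial_val_sub_mid_le_iff hS (x 0)
  rcases tiltSchwarzSpatial_layers hS x with ⟨ha1, ha2, hy1, hy2⟩ | ⟨hb, hfix⟩ | ⟨ha, hb, hy1, hy2⟩
  · have hc' : ¬((x 0 - ((S : ZMod (2 * S + 1)) + 1)).val ≤ S) := by
      rw [hc]; omega
    rw [if_neg hc', hQ x.timeReflect, if_neg hy1, if_neg hy2, hQ x, if_pos ⟨ha1, ha2⟩, zero_add]
  · have ha : ¬(1 ≤ (x 0).val ∧ (x 0).val ≤ S) := by omega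
    rw [if_pos (hc.2 (Or.inr (by omega))), hfix, hQ x, if_neg ha, if_pos hb]
    ring
  · rw [if_pos (hc.2 (by omega)), hQ x, if_neg ha, if_neg hb, add_zero, hQ x.timeReflect,
      if_pos ⟨hy1, hy2⟩, WilsonRP.timeReflect_timeReflect]

end Profiles

/-! ## The stub -/

/-- **Stub (SCHWARZ-SPATIAL).** Reflection Schwarz inequality in direction `0` for the tilt
functionals `Ψ(c) = E_β exp(-∑ₓ c(x) Re tr ρ(U_{(x,o)}))` of a spatial orientation class `o`
(`o.1.1 ≠ 0`) on the odd torus `(ℤ/(2S+1))⁴`, `S ≥ 1`: `Ψ(e)² ≤ Ψ(e⁺) Ψ(e⁻)` for the reflection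
`x₀ ↦ 2 (S + 1) - x₀ = 1 - x₀` about the fixed layer `S + 1`, `e⁺` keeping the layers with
`((S + 1) - x₀).val ≤ S` and `e⁻` those with `(x₀ - (S + 1)).val ≤ S`. -/
theorem stub_tiltSchwarz_spatial : ∀ (S N : ℕ) (G : Type) [Group G] [TopologicalSpace G] [IsTopologicalGroup G] [CompactSpace G] [MeasurableSpace G] [BorelSpace G] (ρ : G →* Matrix (Fin N) (Fin N) ℂ), 1 ≤ S → Continuous ρ → ∀ (β : ℝ), 0 ≤ β → ∀ (o : {q : Fin 4 × Fin 4 // q.1 < q.2}), o.1.1 ≠ 0 → ∀ (e : Literature.MathematicalPhysics.QuantumFieldTheory.Site 4 (2 * S + 1) → ℝ), (∀ x, 0 ≤ e x) → (∀ x, e x ≤ β) → (∫ U, Real.exp (-∑ x : Literature.MathematicalPhysics.QuantumFieldTheory.Site 4 (2 * S + 1), e x * Literature.MathematicalPhysics.QuantumFieldTheory.WilsonRP.plaqRe ρ U (x, o)) ∂(Literature.MathematicalPhysics.QuantumFieldTheory.wilsonMeasure ρ β : MeasureTheory.Measure (Literature.MathematicalPhysics.QuantumFieldTheory.GaugeConfig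 4 (2 * S + 1) G))) ^ 2 ≤ (∫ U, Real.exp (-∑ x : Literature.MathematicalPhysics.QuantumFieldTheory.Site 4 (2 * S + 1), (if (((S : ZMod (2 * S + 1)) + 1) - x 0).val ≤ S then e x else e (Function.update x 0 (2 * ((S : ZMod (2 * S + 1)) + 1) - x 0))) * Literature.MathematicalPhysics.QuantumFieldTheory.WilsonRP.plaqRe ρ U (x, o)) ∂(Literature.MathematicalPhysics.QuantumFieldTheory.wilsonMeasure ρ β : MeasureTheory.Measure (Literature.MathematicalPhysics.QuantumFieldTheory.GaugeConfig 4 (2 * S + 1) G))) * (∫ U, Real.exp (-∑ x : Literature.MathematicalPhysics.QuantumFieldTheory.Site 4 (2 * S + 1), (if (x 0 - ((S : ZMod (2 * S + 1)) + 1)).val ≤ S then e x else e (Function.update x 0 (2 * ((S : ZMod (2 * S + 1)) + 1) - x 0))) * Literature.MathematicalPhysics.QuantumFieldTheory.WilsonRP.plaqRe ρ U (x, o)) ∂(Literature.MathematicalPhysics.QuantumFieldTheory.wilsonMeasure ρ β : MeasureTheory.Measure (Literature.MathematicalPhysics.QuantumFieldTheory.GaugeConfig 4 (2 * S + 1) G)))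 := by
  intro S N G _ _ _ _ _ _ ρ hS hρ β hβ o ho e _ _
  -- the half profiles `eP`, `eQ` and the crossing profile `w = 0`, kept opaque
  obtain ⟨eP, hP⟩ : ∃ eP : Site 4 (2 * S + 1) → ℝ, ∀ x : Site 4 (2 * S + 1), eP x =
      if 1 ≤ (x 0).val ∧ (x 0).val ≤ S then e x else if (x 0).val = S + 1 then e x / 2 else 0 :=
    ⟨_, fun _ => rfl⟩
  obtain ⟨eQ, hQ⟩ : ∃ eQ : Site 4 (2 * S + 1) → ℝ, ∀ x : Site 4 (2 * S + 1), eQ x =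
      if 1 ≤ (x 0).val ∧ (x 0).val ≤ S then e x.timeReflect
      else if (x 0).val = S + 1 then e x / 2 else 0 :=
    ⟨_, fun _ => rfl⟩
  obtain ⟨w, hw⟩ : ∃ w : Site 4 (2 * S + 1) → ℝ, ∀ x : Site 4 (2 * S + 1), w x = 0 :=
    ⟨fun _ => 0, fun _ => rfl⟩
  -- the reflection Schwarz inequality of crux `LatticeGapOnTrajectory` from the landed (A)
  have key := schwarz_profiles ρ o stub_oddRPCrossTilt hS hρ hβ eP eQ w
    (tiltSchwarzSpatial_support o ho e eP e hP)
    (tiltSchwarzSpatial_support o ho e eQ (fun x => e x.timeReflect) hQ)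
    (fun x h => absurd (hw x) h) (fun x => (hw x).ge) (fun x => (hw x).le.trans hβ)
  simp only [tiltSchwarzSpatial_profile_mixed hS o ho e eP eQ w hP hQ hw,
    tiltSchwarzSpatial_profile_plus hS o ho e eP w hP hw,
    tiltSchwarzSpatial_profile_minus hS o ho e eQ w hQ hw] at key
  exact key

end Summit.QuantumFields.YangMills.Theorems.NonSimplyConnectedLatticeGap
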